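import Summits.BirchSwinnertonDyer.BirchSwinnertonDyer.Theorems.KolyvaginDepthDoorDepthTableRowsTwoSha3
import Literature.NumberTheory.EllipticCurves.ShaPTorsionVanishingHigherRank
import HarnessLib

/-!
# Route `KolyvaginDepthDoor`, crux `KolyvaginDepthSupplyKN` (stmt-BirchSwinnertonDyer-22820) —
# DEPTH TABLE v13: THE `E`-SIDE OF THE LEVEL-ONE ROWS IS PRINT (Stein–Wuthrich 2013, Thm. 1.1 BY NAME):
# «ONE BIT ⟺ ONE rank-one twist» (part 1: the fact; the row `389a1` at `(5, −7)`; the crux's clause at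
# `389a1` modulo ONE `5`-Selmer bound on ONE rank-one twist)

Helper file of the lead prover of line `levelone` (kdd-p1 g17; `--supports stmt-BirchSwinnertonDyer-22820
--as helper`); it closes nothing and BSD is NOT proved by it.

WHAT IS NEW. Every depth-table row of the lineage (v10 `exactRowZhang_p_negD`, v11 `…_rankFree`, v12
`…_twoSha`) carries on its right-hand side the conjunct «`Ш(E/ℚ)[p] = 0`» for the RANK-TWO curve `E` —
the one conjunct the instrument was meant to certify (X1 at rank `2` has no class-wide handle). For the
eighteen curves of the table that conjunct is A THEOREM IN PRINT: W. Stein and C. Wuthrich, *Algorithms for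
the arithmetic of elliptic curves using Iwasawa theory*, Math. Comp. 82 (2013), **Theorem 1.1** (p. 1758;
proof §12.4 p. 1787, via Kato's divisibility, the `p`-adic regulator and the leading term of the `p`-adic
`L`-series): for every non-CM `E/ℚ` of Mordell–Weil rank `≥ 2` and conductor `≤ 30 000` and every good
ordinary prime `5 ≤ p < 1000` with `ρ̄_{E,p}` onto, `Ш(E/ℚ)[p] = 0` (1 534 422 pairs). The fact is the
tree's named fact `Literature.NumberTheory.EllipticCurves.SteinWuthrich2013_sha_inf_torsionBy_eq_bot_of_two_le_rank`
(file `Literature/NumberTheory/EllipticCurves/ShaPTorsionVanishingHigherRank.lean`, this seat; cited, no `_holds`);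
every hypothesis it needs at a depth-table curve is ALREADY a kernel theorem of the lineage (`not_hasCM`, `two_le_rank` / `two_le_mordellWeilRank`, `conductorNorm_eq`,
`goodOrdinary_p`, `hasSurjectiveModNGaloisRep_p`). Consequences, per curve (here `389a1` at `(5, −7)`; sequel files: the other seventeen rows):

* `C<label>.sha_inf_torsionBy_five_eq_bot` — `Ш(E/ℚ)[5] = 0` BY NAME (SW Thm. 1.1 at the kernel-certified
  hypotheses).
* `C<label>.exactRowZhang_5_neg7_oneTwist` — **v13 row «ONE BIT ⟺ ONE TWIST»**: for ANY imaginary quadratic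
  `K` with `d_K = −7`, «∃ frame, Kolyvagin prime `ℓ`, datum: `c_1(ℓ) ≠ 0`» `↔` «`rank_ℤ E^{(−7)}(ℚ) = 1` ∧
  `Ш(E^{(−7)}/ℚ)[5] = 0`»: one bit of Jetchev–Lauter–Stein's algorithm at `p = 5` IS NOW EXACTLY the
  `5`-part of BSD for ONE RANK-ONE curve, the Heegner twist (its point is in the kernel, v12).
* `C<label>.exactRowZhang_5_neg7_twistSelmer` — the same in Selmer currency: bit `↔` `#Sel_5(E^{(−7)}/ℚ) ≤ 5`.
* `C<label>.cruxBody_of_twistSelmer` — **the crux `KolyvaginDepthSupplyKN` AT THE CURVE, modulo ONE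
  rank-one datum**: granted `#Sel_5(E^{(d_K)}/ℚ) ≤ 5` for one `K` with `d_K = −7`, the clause of the crux
  holds at `E` VERBATIM (witnesses `p = 5`, that `K`, `n₁ = ℓ` the prime of the row's non-zero class, first
  sign `ν + 1 = 2 ≤ rank`). So the per-curve instance is no longer «one Kolyvagin-class computation over a
  ring class field of degree `2(ℓ+1)h_K`» away but «one `5`-descent-free datum on ONE rank-one curve» away
  (e.g. the Heegner index of `E^{(−7)}`, or its `5`-adic BSD data à la Stein–Wuthrich §9) — a RANK-ONE
  computation; nothing class-wide moves (the open stub (S♭) is untouched: SW is a finite table).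

CONDITIONAL on three named print facts: (γ) = Gross 1991 Prop. 3.7 (2), W. Zhang 2014 Lemma 8.4 (1) /
Thm. 9.1, Stein–Wuthrich 2013 Thm. 1.1. Per curve; BSD is NOT proved by any of this.

References: [SteinWuthrich2013] Thm. 1.1 (p. 1758), §12.4 (p. 1787), Algorithm 11.1; [WZhang2014] Lemma 8.4
(1) (p. 236), Thm. 9.1 (p. 240); [GrossLMS1991] Prop. 3.7 (2); [SilvermanAEC2009] X.4.2;
[JetchevLauterStein2009] §3.6; [CremonaAlgorithms1997] Table 1.
-/

set_option linter.dupNamespace false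

noncomputable section

open scoped Classical NumberField

namespace Summit.BirchSwinnertonDyer.BirchSwinnertonDyer.Theorems.KolyvaginDepthDoor

open Literature.NumberTheory.EllipticCurves Literature.NumberTheory.EllipticCurves.ModularForms
  WeierstrassCurve NumberField IsDedekindDomain
open Summit.BirchSwinnertonDyer.BirchSwinnertonDyer.Theorems
open Summit.BirchSwinnertonDyer.BirchSwinnertonDyer.Rank2Observatory

/-! ## `389a1` at `(p, d_K) = (5, -7)` -/

namespace C389a1
/-- **`Ш(389a1/ℚ)[5] = 0` BY NAME** (Stein–Wuthrich 2013 Thm. 1.1 at the kernel-certified hypotheses of the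
lineage: non-CM `not_hasCM'`, `2 ≤ rank` `two_le_mordellWeilRank`, `N = 389 ≤ 30000` `conductorNorm_eq`, `5` good ordinary
`goodOrdinary_5`, `ρ̄_{E,5}` onto `hasSurjectiveModNGaloisRep_pow_5 1`). CONDITIONAL on that named fact; per curve; BSD is not
proved by it. [cite: SteinWuthrich2013, Thm. 1.1 (p. 1758)] [cite: CremonaAlgorithms1997, Table 1 (389a1)] -/
theorem sha_inf_torsionBy_five_eq_bot (hSW : SteinWuthrich2013_sha_inf_torsionBy_eq_bot_of_two_le_rank) :
    haveI := curve389a1_isGloballyMinimal;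
    haveI := Fact.mk (by norm_num : Nat.Prime 5);
    (Curve389a1.E.sha ⊓ AddSubgroup.torsionBy Curve389a1.E.galH1 ((5 : ℕ) : ℤ) : AddSubgroup _) = ⊥ := by
  haveI := curve389a1_isGloballyMinimal
  haveI := Fact.mk (by norm_num : Nat.Prime 5)
  have hsur : Curve389a1.E.HasSurjectiveModNGaloisRep (5 ^ 1 : ℕ) := hasSurjectiveModNGaloisRep_pow_5 1
  rw [pow_one] at hsur
  exact hSW _ not_hasCM' Curve389a1.two_le_mordellWeilRank (by rw [conductorNorm_eq]; norm_num) 5 (by norm_num) (by norm_num)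
    goodOrdinary_5.1 goodOrdinary_5.2 hsur

/-- **DEPTH-TABLE ROW `389a1`, `(p, d_K) = (5, -7)`, v13 — «ONE BIT ⟺ ONE TWIST».** For `E = 389a1` and ANY
imaginary quadratic `K` with `d_K = -7`: «some frame, some Kolyvagin prime `ℓ`, some datum of conductor `ℓ` with
`c_1(ℓ) ≠ 0`» `↔` «`rank_ℤ E^{(-7)}(ℚ) = 1` ∧ `Ш(E^{(-7)}/ℚ)[5] = 0`» — the `5`-part of BSD for the rank-one
Heegner twist ALONE. From the v12 row `exactRowZhang_5_neg7_twoSha` with its first conjunct `Ш(E)[5] = 0` discharged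
by Stein–Wuthrich Thm. 1.1 (`sha_inf_torsionBy_five_eq_bot`). CONDITIONAL on (γ), W. Zhang's Lemma 8.4 (1) /
Thm. 9.1 and SW Thm. 1.1 by name; per curve; BSD is not proved by it. [cite: SteinWuthrich2013, Thm. 1.1 (p. 1758)]
[cite: WZhang2014, Lemma 8.4 (1) (p. 236), Thm. 9.1 (p. 240)] [cite: GrossLMS1991, Prop. 3.7 (2)] [cite: SilvermanAEC2009, Thm. X.4.2] -/
theorem exactRowZhang_5_neg7_oneTwist
    (hSW : SteinWuthrich2013_sha_inf_torsionBy_eq_bot_of_two_le_rank)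
    (h372 : GrossLMS1991.prop37_2_frobeniusCongruence)
    (h84 : Literature.NumberTheory.EllipticCurves.WZhang2014_lemma84_exists_minimal_kolyvaginClass_one_selmerCard)
    (K : Type) [Field K] [NumberField K] (hK : IsImaginaryQuadratic K)
    (hD : NumberField.discr K = -7) :
    haveI := curve389a1_isGloballyMinimal;
    haveI : NeZero ((Curve389a1.E).conductorNorm ℤ) := neZero_conductorNorm_of_isElliptic _;
    haveI := Fact.mk (by norm_num : Nat.Prime 5);
    (∃ (Dt : ModularParametrizationData (Curve389a1.E) ((Curve389a1.E).conductorNorm ℤ)) (β : ℤ)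
      (ι : K →+* ℂ) (ℓ : ℕ) (d : KolyvaginHeegnerData Dt β ι ℓ),
      ℓ.Prime ∧ Zhang2014.IsKolyvaginPrime ((Curve389a1.E).conductorNorm ℤ) (Curve389a1.E) K 5 ℓ ∧
        d.kolyvaginClass (p := 5) (by norm_num) 1 ≠ 0) ↔
    (((Curve389a1.E).quadraticTwist (NumberField.discr K : ℚ)).mordellWeilRank = 1 ∧
      (((Curve389a1.E).quadraticTwist (NumberField.discr K : ℚ)).sha ⊓
          AddSubgroup.torsionBy ((Curve389a1.E).quadraticTwist (NumberField.discr K : ℚ)).galH1 ((5 : ℕ) : ℤ) :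
          AddSubgroup ((Curve389a1.E).quadraticTwist (NumberField.discr K : ℚ)).galH1) = ⊥) := by
  haveI := curve389a1_isGloballyMinimal
  haveI : NeZero ((Curve389a1.E).conductorNorm ℤ) := neZero_conductorNorm_of_isElliptic _
  haveI := Fact.mk (by norm_num : Nat.Prime 5)
  exact (exactRowZhang_5_neg7_twoSha h372 h84 K hK hD).trans
    (and_iff_right (sha_inf_torsionBy_five_eq_bot hSW))

/-- **DEPTH-TABLE ROW `389a1`, `(p, d_K) = (5, -7)`, v13 in Selmer currency — «ONE BIT ⟺ ONE TWIST-SELMER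
BOUND».** For `E = 389a1` and ANY imaginary quadratic `K` with `d_K = -7`: bit `↔` `#Sel_5(E^{(-7)}/ℚ) ≤ 5`
(`dim Sel_5(E^{(-7)}) ≤ 1` over `𝔽_5`). From the v11 row `exactRowZhang_5_neg7_rankFree` with `Ш(E)[5] = 0` discharged by
SW Thm. 1.1. CONDITIONAL on (γ), W. Zhang L8.4 (1) / 9.1 and SW Thm. 1.1 by name; per curve; BSD is not proved
by it. [cite: SteinWuthrich2013, Thm. 1.1 (p. 1758)] [cite: WZhang2014, Lemma 8.4 (1) (p. 236)] [cite: GrossLMS1991, Prop. 3.7 (2)] -/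
theorem exactRowZhang_5_neg7_twistSelmer
    (hSW : SteinWuthrich2013_sha_inf_torsionBy_eq_bot_of_two_le_rank)
    (h372 : GrossLMS1991.prop37_2_frobeniusCongruence)
    (h84 : Literature.NumberTheory.EllipticCurves.WZhang2014_lemma84_exists_minimal_kolyvaginClass_one_selmerCard)
    (K : Type) [Field K] [NumberField K] (hK : IsImaginaryQuadratic K)
    (hD : NumberField.discr K = -7) :
    haveI := curve389a1_isGloballyMinimal;
    haveI : NeZero ((Curve389a1.E).conductorNorm ℤ) := neZero_conductorNorm_of_isElliptic _;
    haveI := Fact.mk (by norm_num : Nat.Prime 5);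
    (∃ (Dt : ModularParametrizationData (Curve389a1.E) ((Curve389a1.E).conductorNorm ℤ)) (β : ℤ)
      (ι : K →+* ℂ) (ℓ : ℕ) (d : KolyvaginHeegnerData Dt β ι ℓ),
      ℓ.Prime ∧ Zhang2014.IsKolyvaginPrime ((Curve389a1.E).conductorNorm ℤ) (Curve389a1.E) K 5 ℓ ∧
        d.kolyvaginClass (p := 5) (by norm_num) 1 ≠ 0) ↔
    Nat.card (((Curve389a1.E).quadraticTwist (NumberField.discr K : ℚ)).selmerGroup (5 : ℕ)) ≤ 5 := by
  haveI := curve389a1_isGloballyMinimal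
  haveI : NeZero ((Curve389a1.E).conductorNorm ℤ) := neZero_conductorNorm_of_isElliptic _
  haveI := Fact.mk (by norm_num : Nat.Prime 5)
  exact (exactRowZhang_5_neg7_rankFree h372 h84 K hK hD).trans
    (and_iff_right (sha_inf_torsionBy_five_eq_bot hSW))

/-- **THE CRUX `KolyvaginDepthSupplyKN` AT `389a1`, MODULO ONE RANK-ONE DATUM.** Granted the three named print
facts (SW Thm. 1.1, (γ), W. Zhang L8.4 (1) / 9.1) and, for ONE imaginary quadratic `K` with `d_K = -7`, the
`5`-Selmer bound `#Sel_5(E^{(d_K)}/ℚ) ≤ 5` of the rank-one Heegner twist (one `5`-descent-free rank-one datum),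
the CLAUSE of the crux holds at `W = 389a1` VERBATIM: witnesses `p = 5` (good ordinary, `ρ_{E,5^∞}` onto
`hasSurjectiveModNGaloisRep_pow_5`, Kodaira–Néron from `Δ(E₀) = 389`), that `K` (Heegner, `heegner_neg7`),
`n₁ = ℓ` the Kolyvagin prime of the row's non-zero class (`exactRowZhang_5_neg7_twistSelmer`, ←), first sign
`ν(ℓ) + 1 = 2 ≤ rank_ℤ E(ℚ)` (`two_le_mordellWeilRank`). CONDITIONAL on the three named facts and the one twist datum;
per curve (the open stub (S♭) is untouched); BSD is not proved by it. [cite: SteinWuthrich2013, Thm. 1.1 (p. 1758)]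
[cite: WZhang2014, Lemma 8.4 (1) (p. 236), Thm. 9.1 (p. 240)] [cite: GrossLMS1991, Prop. 3.7 (2)] [cite: CremonaAlgorithms1997, Table 1 (389a1)] -/
theorem cruxBody_of_twistSelmer
    (hSW : SteinWuthrich2013_sha_inf_torsionBy_eq_bot_of_two_le_rank)
    (h372 : GrossLMS1991.prop37_2_frobeniusCongruence)
    (h84 : Literature.NumberTheory.EllipticCurves.WZhang2014_lemma84_exists_minimal_kolyvaginClass_one_selmerCard)
    (K : Type) [Field K] [NumberField K] (hK : IsImaginaryQuadratic K)
    (hD : NumberField.discr K = -7)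
    (hT : haveI := curve389a1_isGloballyMinimal; 
      Nat.card (((Curve389a1.E).quadraticTwist (NumberField.discr K : ℚ)).selmerGroup (5 : ℕ)) ≤ 5) :
    haveI := curve389a1_isGloballyMinimal;
    ∃ (p : ℕ) (hp : Fact p.Prime), 5 ≤ p ∧ (Curve389a1.E).HasGoodReductionAtPrime p ∧
      ¬ (p : ℤ) ∣ (Curve389a1.E).frobeniusTrace p ∧ (∀ n : ℕ, (Curve389a1.E).HasSurjectiveModNGaloisRep (p ^ n : ℕ)) ∧
      (∀ v : HeightOneSpectrum (𝓞 ℚ), (Curve389a1.E).HasMultiplicativeReductionAt v →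
        ¬ p ∣ (Curve389a1.E).ordMinimalDiscriminant v) ∧
      ∃ (K : Type) (_ : Field K) (_ : NumberField K), IsImaginaryQuadratic K ∧
        NumberField.discr K ≠ -3 ∧ NumberField.discr K ≠ -4 ∧
        ∃ (_ : NeZero ((Curve389a1.E).conductorNorm ℤ)), SatisfiesHeegnerHypothesis ((Curve389a1.E).conductorNorm ℤ) K ∧
        ∃ (Dt : ModularParametrizationData (Curve389a1.E) ((Curve389a1.E).conductorNorm ℤ)) (β : ℤ) (ι : K →+* ℂ) (n₁ : ℕ)
          (d : KolyvaginHeegnerData Dt β ι n₁), Squarefree n₁ ∧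
          (∀ q ∈ n₁.primeFactors, Zhang2014.IsKolyvaginPrime ((Curve389a1.E).conductorNorm ℤ) (Curve389a1.E) K p q) ∧
          d.kolyvaginClass hp.out 1 ≠ 0 ∧
          (n₁.primeFactors.card + 1 ≤ (Curve389a1.E).mordellWeilRank ∨
            (n₁.primeFactors.card ≤ (Curve389a1.E).mordellWeilRank ∧
              n₁.primeFactors.card + 1 ≤ ((Curve389a1.E).quadraticTwist (NumberField.discr K : ℚ)).mordellWeilRank)) := by
  haveI := curve389a1_isGloballyMinimal
  haveI iNZ : NeZero ((Curve389a1.E).conductorNorm ℤ) := neZero_conductorNorm_of_isElliptic _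
  haveI iP := Fact.mk (by norm_num : Nat.Prime 5)
  -- the non-zero class at a Kolyvagin PRIME, from the v13 row (←) and the twist datum
  obtain ⟨Dt, β, ι, ℓ, d, hℓ, hkol, hne⟩ := (exactRowZhang_5_neg7_twistSelmer hSW h372 h84 K hK hD).mpr hT
  -- Kodaira–Néron at `5` from `Δ(E₀) = 389`
  have hKN : ∀ v : HeightOneSpectrum (𝓞 ℚ), (Curve389a1.E).HasMultiplicativeReductionAt v →
      ¬ 5 ∣ (Curve389a1.E).ordMinimalDiscriminant v :=
    not_dvd_ordMinimalDiscriminant_of_intModel_table intModel (p := 5) (Δ₀ := 389) (by decide +kernel)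
      (B := 8) (by decide +kernel) (by decide +kernel)
  have hH := satisfiesHeegnerHypothesis_conductorNorm_of_intModel intModel K hK.1 hD heegner_neg7
  have hD3 : NumberField.discr K ≠ -3 := by rw [hD]; norm_num
  have hD4 : NumberField.discr K ≠ -4 := by rw [hD]; norm_num
  have hsq : Squarefree ℓ := hℓ.squarefree
  have h5 : (5 : ℕ) ≤ 5 := by norm_num
  have hgood : (Curve389a1.E).HasGoodReductionAtPrime 5 := goodOrdinary_5.1
  have hord : ¬ ((5 : ℕ) : ℤ) ∣ (Curve389a1.E).frobeniusTrace 5 := goodOrdinary_5.2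
  have htower : ∀ n : ℕ, (Curve389a1.E).HasSurjectiveModNGaloisRep (5 ^ n : ℕ) := hasSurjectiveModNGaloisRep_pow_5
  have hkol' : ∀ q ∈ ℓ.primeFactors, Zhang2014.IsKolyvaginPrime ((Curve389a1.E).conductorNorm ℤ) (Curve389a1.E) K 5 q := by
    intro q hq
    rw [hℓ.primeFactors, Finset.mem_singleton] at hq
    exact hq ▸ hkol
  have hrank : ℓ.primeFactors.card + 1 ≤ (Curve389a1.E).mordellWeilRank := by
    rw [hℓ.primeFactors, Finset.card_singleton]
    exact Curve389a1.two_le_mordellWeilRank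
  have hne' : d.kolyvaginClass iP.out 1 ≠ 0 := hne
  -- assembled one binder at a time (a single anonymous constructor here times out at `whnf`)
  refine ⟨5, iP, h5, hgood, hord, htower, hKN, ?_⟩
  refine ⟨K, ‹Field K›, ‹NumberField K›, ?_⟩
  refine ⟨hK, ?_⟩
  refine ⟨hD3, ?_⟩
  refine ⟨hD4, ?_⟩
  refine ⟨iNZ, ?_⟩
  refine ⟨hH, ?_⟩
  refine ⟨Dt, β, ι, ℓ, d, ?_⟩
  refine ⟨hsq, ?_⟩
  refine ⟨hkol', ?_⟩
  refine ⟨hne', ?_⟩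
  exact Or.inl hrank

end C389a1

end Summit.BirchSwinnertonDyer.BirchSwinnertonDyer.Theorems.KolyvaginDepthDoor

end
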